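import Summits.Ventures.HSemireg.WedgeHankelPairMixingPermutation
import Summits.Ventures.HSemireg.WedgeHankelDivisorImage

/-!
# Venture HSemireg — THE IMAGE SIDE OF K25 IS TRIVIAL BELOW THE TOP: `V(univ, w_N q, k) ⊓ Sp(pairs ⊆ T) = 0` for every `T ≠ [N]` (every product `θ ∧ w_N(q)` has a letter in
# EVERY pair), and `= V(univ, w_N q, k)` of dimension `C(N,k) · rank H_k(q)` at `T = [N]`

HONEST FRAMING. Part of the Lean index of the computation cell `pub-hsemireg` (seat p10 gen 22, Sunday typer «UNIFORM-IN-n»).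
Finite-dimensional EXTERIOR ALGEBRA over a field ONLY: no variety, no cohomology theory, no sheaf, no Ext group, no semiregularity map;
nothing here says that HC / HC_CM / HC_AV holds; no Literature fact is declared or used.  Custodian versions as in `WedgeHankelSiegelIdeal` (1/3); the dictionary (`V(univ, w_N q, k)` =
th-7's factor rank space = the products `θ ∧ w_N(q)`, `θ` a `k`-form; `Sp(pairs ⊆ T)` = the forms on the sub-product of the pairs in `T`) is QUOTED, never asserted.

WHAT IS IN THE TREE.  `Sp`, `mul_mem_Sp`, `Sp_inf_Sp_eq_bot`, `Sp_mono` (`WedgeWeilSpan`), the pair type `ptype`, `ptype_union`, `ptype_of_Tr`, `w_mem_Sp_Tr` (`WedgeHankelPairGrading`: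
th-7's class is TRANSVERSAL), `V_eq_map` (`WedgeKunnethKernel`), `finrank_V_w` (`WedgeHankelDivisorImage`: `dim V(univ, w_N q, k) = C(N,k) · rank H_k(q)`), K25 (this seat,
`WedgeHankelPairMixingPermutation`): `finrank_V_w_inf_Sp_pairs_eq_of_card_eq` («depends on `|T|` only») — its VALUE was not typed.  THIS FILE (namespace
`Summit.Ventures.HSemireg.Wedge.HankelPairMixing`, continued; imports K25 + `WedgeHankelDivisorImage`):
* §364 **`V_w_le_Sp_meets_every_pair`: `V K univ (w K N N q) k ≤ Sp K (fun u => ∀ c, 0 < ptype u c)`** (a `k`-form times the transversal class `w_N(q)` only has monomials with a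
  letter in every pair), `Sp_pairs_disjoint_meets` (a monomial on the pairs of `T ∌ c` misses the pair `c`), **`V_w_inf_Sp_pairs_eq_bot`: `V ⊓ Sp(pairs ⊆ T) = ⊥` for every
  `T ≠ univ`**, `finrank_V_w_inf_Sp_pairs_of_ne_univ` (`= 0`).
* §365 the top: `Sp_pairs_univ_eq_top` (`Sp(pairs ⊆ univ) = ⊤`), **`finrank_V_w_inf_Sp_pairs_univ`: `dim (V ⊓ Sp(pairs ⊆ univ)) = C(N,k) · rank (hankel1 K N k q)`**, and the
  two-valued law **`finrank_V_w_inf_Sp_pairs`: `dim (V(univ, w_N q, k) ⊓ Sp(pairs ⊆ T)) = if T = univ then C(N,k) · rank H_k(q) else 0`** (every `T`, `k`, `q`, field).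
Nothing Ext-side.  New names only.
-/

open Module

namespace Summit.Ventures.HSemireg.Wedge.HankelPairMixing

open Summit.Ventures.HSemireg.Wedge Summit.Ventures.HSemireg.Wedge.Kunneth Summit.Ventures.HSemireg.Wedge.Hankel
  Summit.Ventures.HSemireg.Wedge.KunnethKernel Summit.Ventures.HSemireg.Wedge.Weil Summit.Ventures.HSemireg.Wedge.HankelPairGrading
  Summit.Ventures.HSemireg.Wedge.HankelFrameChange

variable (K : Type*) [Field K] {N : ℕ}

/-! ## §364. Below the top the image meets no sub-box -/

/-- **every product `θ ∧ w_N(q)` (`θ` a `k`-form) lies in the span of the monomials with a letter in EVERY pair** (th-7's class is transversal: `ptype (s ∪ t) = ptype s + 1`). -/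
theorem V_w_le_Sp_meets_every_pair (q : ℕ → K) (k : ℕ) :
    V K (In N) Finset.univ (w K N N q) k ≤ Sp K (fun u : Finset (In N) => ∀ c : Fin N, 0 < ptype u c) := by
  rw [V_eq_map]
  rintro _ ⟨θ, hθ, rfl⟩
  rw [LinearMap.mulRight_apply]
  rw [Hom_eq_Sp] at hθ
  refine mul_mem_Sp (fun s t hd _ ht c => ?_) hθ (w_mem_Sp_Tr K q)
  rw [ptype_union hd, ptype_of_Tr ht, Pi.add_apply]
  omega

omit [Field K] in
/-- a monomial all of whose letters lie in pairs of `T` has no letter in a pair `c ∉ T`. -/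
theorem Sp_pairs_disjoint_meets {T : Finset (Fin N)} {c : Fin N} (hc : c ∉ T) (s : Finset (In N)) (hs : ∀ i ∈ s, pr i ∈ T) : ¬ (∀ c' : Fin N, 0 < ptype s c') := by
  intro h
  have h1 := h c
  simp only [ptype, Finset.card_pos] at h1
  obtain ⟨i, hi⟩ := h1
  rw [Finset.mem_filter] at hi
  exact hc (hi.2 ▸ hs i hi.1)

/-- **`V(univ, w_N q, k) ⊓ Sp(pairs ⊆ T) = ⊥` for every `T ≠ univ`** — no nonzero product `θ ∧ w_N(q)` lives on a proper sub-box (every `k`, `q`, field). -/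
theorem V_w_inf_Sp_pairs_eq_bot (q : ℕ → K) (k : ℕ) {T : Finset (Fin N)} (hT : T ≠ Finset.univ) :
    V K (In N) Finset.univ (w K N N q) k ⊓ Sp K (fun s : Finset (In N) => ∀ i ∈ s, pr i ∈ T) = ⊥ := by
  obtain ⟨c, hc⟩ : ∃ c : Fin N, c ∉ T := by
    by_contra h
    push Not at h
    exact hT (Finset.eq_univ_of_forall h)
  rw [eq_bot_iff, ← Sp_inf_Sp_eq_bot (K := K) (P := fun u : Finset (In N) => ∀ c' : Fin N, 0 < ptype u c') (Q := fun s : Finset (In N) => ∀ i ∈ s, pr i ∈ T)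
    (fun s hs hq => Sp_pairs_disjoint_meets hc s hq hs)]
  exact inf_le_inf_right _ (V_w_le_Sp_meets_every_pair K q k)

/-- **`dim (V(univ, w_N q, k) ⊓ Sp(pairs ⊆ T)) = 0` for `T ≠ univ`.** -/
theorem finrank_V_w_inf_Sp_pairs_of_ne_univ (q : ℕ → K) (k : ℕ) {T : Finset (Fin N)} (hT : T ≠ Finset.univ) :
    finrank K ↥(V K (In N) Finset.univ (w K N N q) k ⊓ Sp K (fun s : Finset (In N) => ∀ i ∈ s, pr i ∈ T)) = 0 := by
  rw [V_w_inf_Sp_pairs_eq_bot K q k hT, finrank_bot]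

/-! ## §365. The top -/

/-- `Sp(pairs ⊆ univ) = ⊤`: every monomial qualifies. -/
theorem Sp_pairs_univ_eq_top : Sp K (fun s : Finset (In N) => ∀ i ∈ s, pr i ∈ (Finset.univ : Finset (Fin N))) = ⊤ := by
  rw [eq_top_iff]
  intro v _
  have hv : v ∈ Submodule.span K (Set.range (B K (In N))) := by rw [(B K (In N)).span_eq]; exact Submodule.mem_top
  refine Submodule.span_mono ?_ hv
  rintro _ ⟨s, rfl⟩
  exact ⟨s, fun i _ => Finset.mem_univ _, rfl⟩

/-- **at the top: `dim (V(univ, w_N q, k) ⊓ Sp(pairs ⊆ univ)) = C(N,k) · rank (hankel1 K N k q)`** (th-7's image count `finrank_V_w`). -/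
theorem finrank_V_w_inf_Sp_pairs_univ (q : ℕ → K) (k : ℕ) :
    finrank K ↥(V K (In N) Finset.univ (w K N N q) k ⊓ Sp K (fun s : Finset (In N) => ∀ i ∈ s, pr i ∈ (Finset.univ : Finset (Fin N))))
      = N.choose k * (hankel1 K N k q).rank := by
  rw [Sp_pairs_univ_eq_top, inf_top_eq, finrank_V_w]

/-- **THE TWO-VALUED LAW (value of K25's image theorem): `dim (V(univ, w_N q, k) ⊓ Sp(pairs ⊆ T)) = if T = univ then C(N,k) · rank H_k(q) else 0`** — every `T`, `k`, `q`, field. -/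
theorem finrank_V_w_inf_Sp_pairs (q : ℕ → K) (k : ℕ) (T : Finset (Fin N)) :
    finrank K ↥(V K (In N) Finset.univ (w K N N q) k ⊓ Sp K (fun s : Finset (In N) => ∀ i ∈ s, pr i ∈ T))
      = if T = Finset.univ then N.choose k * (hankel1 K N k q).rank else 0 := by
  split_ifs with hT
  · rw [hT, finrank_V_w_inf_Sp_pairs_univ]
  · exact finrank_V_w_inf_Sp_pairs_of_ne_univ K q k hT

end Summit.Ventures.HSemireg.Wedge.HankelPairMixing
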